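import Summits.BirchSwinnertonDyer.BirchSwinnertonDyer.Theorems.SignedLowerHalvesSprungLowerDivisibilityAtThreeSlopeSeparationDoor
import Summits.BirchSwinnertonDyer.BirchSwinnertonDyer.Theorems.SignedLowerHalvesKobayashiLowerHalfSemistableDefectPrime
import HarnessLib

/-!
# Crux `SprungLowerDivisibilityAtThree` (K1, item stmt-BirchSwinnertonDyer-19875), line `chromatic-common-zeros`, stub K_spor per pair:
# EISENSTEIN RIGIDITY — a power series with `μ = 0` and constant term of valuation ONE has a SINGLE height-one prime (its Weierstrass
# polynomial is Eisenstein), so two such series share a height-one prime iff they generate the same ideal; the equal-`λ` complement of the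
# slope-separation door (w3 g3, p624687/p625238)

Cell `bsd-ssimc` (host), width seat `cruxlead-stmt-BirchSwinnertonDyer-19875-w2` (g3) under the 19875 lead; `--supports` 19875 `--as helper`;
theorems only; route-independent imports; closes NO item; registry unchanged (skeleton v8). K1, BSD and leaf X8 are NOT proved by anything here;
every per-pair hypothesis below is a displayed DATUM (census input) or a displayed named fact.

## What is proved

* §1 (general `p`, pure `Λ = ℤ_p⟦T⟧` algebra) — for `F ∈ Λ`, `F ≢ 0 (mod p)`, with `‖F(0)‖ = p⁻¹`: the Weierstrass polynomial `P_F` (Mathlib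
  `PowerSeries.weierstrassDistinguished`) is EISENSTEIN at `(p)` (`isEisensteinAt_weierstrassDistinguished`: distinguished ⇒ monic with lower
  coefficients in `(p)`; `P_F(0)·U_F(0) = F(0)` with `U_F(0)` a unit ⇒ `‖P_F(0)‖ = p⁻¹` ⇒ `P_F(0) ∉ (p²)`), hence irreducible (Mathlib
  `Polynomial.IsEisensteinAt.irreducible`) and PRIME in `Λ` (`prime_coe_weierstrassDistinguished`: `Λ/(P_F) ≅ ℤ_p[T]/(P_F)` by Weierstrass
  division, `IsDistinguishedAt.algEquivQuotient`, as in `DefectPrime.prime_coe_cyclotomic_comp`); so every height-one prime containing `F` IS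
  `(P_F)` (`eq_span_weierstrassDistinguished_of_mem`), and **two such series `F`, `G` lie in a common height-one prime iff `(F) = (G)`**
  (`span_eq_span_of_mem_of_mem_of_eisenstein`; contrapositive `not_mem_and_mem_of_span_ne`). When `λ(F) ≠ λ(G)` the ideals differ automatically
  — the slope-separation door `ChromaticSlopeSeparation.not_mem_and_mem_of_lam_ne` (w3 g3); the NEW reach is `λ(F) = λ(G)`.
  A finite certificate for `(F) ≠ (G)` (`span_ne_of_coeff_cross_ne`): if `F = u·G` with `u ∈ Λˣ` then `F₀ G_n ≡ G₀ F_n` modulo `p·(F₀)` …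
  stated in the usable form «`F_n·G₀ − F₀·G_n ∉ (p²)` with `n = λ`» is NOT attempted here (the datum `(F) ≠ (G)` is displayed as such).
* §2 (X8, `--supports 19875`) — **(R9) `sprungSharpFlatLowerDivisibility_of_span_ne_of_norm_ratPlusSymbol`**: on an X8 pair with
  `‖[0]⁺_f‖₃ = 1/3` (so `r_an = 0` and `‖L♯(0)‖ = ‖L♭(0)‖ = 1/3`, w3's `X8.norm_constantCoeff_chromaticL_eq`), `μ♯ = μ♭ = 0` and the datum
  `(L♯) ≠ (L♭)`, NO height-one prime contains both colours ⇒ K1 for BOTH colours by R0 (`sprungSharpFlatLowerDivisibility_of_noCommonZero`,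
  p609846), modulo `h714`, `h3`, `hJ` only. x8 census reach (`ty3/data/x8_r5_lambda_mu.tsv`, DATA): the 36 rank-0 cells with
  `v₃(L♯(0)) = v₃(L♭(0)) = 1`, of which 20 have `λ♯ ≠ λ♭` (w3's R4) and **16 have `λ♯ = λ♭`** (12 × (2,2), 4 × (4,4)) — the latter are new,
  given the one datum `(L♯) ≠ (L♭)` (decidable from finitely many 3-adic digits: e.g. `v₃(F_λ G₀ − F₀ G_λ) = 1` suffices, F_λ, G_λ the leading
  unit coefficients — x8 tooling, not kernel).

References: [Washington1997] §7.1 Thm. 7.3 (Weierstrass preparation), §13.2; [Lang1990] Ch. 5 §2; [Sprung2012] Prop. 6.14 (p. 1498), Thm. 7.14 (p. 1504),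
Prop. 7.19 and Main Conj. 7.21 (p. 1505); Mathlib `RingTheory/PowerSeries/WeierstrassPreparation`, `RingTheory/Polynomial/Eisenstein/Basic`,
`RingTheory/Ideal/UFD` (`Ideal.eq_span_singleton_of_height_eq_one`); tree: `…SlopeSeparation(Door)` (p624687, p625238), `…ChromaticPerPair` (p609846),
`…KobayashiLowerHalfSemistableDefectPrime` (pattern of `prime_coe_cyclotomic_comp`), `Rank1Residual/X1/MuLambdaAlgebra` (`mu`, `pfree`, `red`).
-/

set_option linter.dupNamespace false
set_option autoImplicit false

noncomputable section

open scoped Classical NumberField MatrixGroups ModularForm Polynomial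

open NumberField IsDedekindDomain CongruenceSubgroup WeierstrassCurve Field Polynomial
  Literature.NumberTheory.EllipticCurves Literature.NumberTheory.EllipticCurves.ModularForms
  Literature.NumberTheory.EllipticCurves.ZpExtension Literature.NumberTheory.EllipticCurves.Sprung2017
  Literature.NumberTheory.EllipticCurves.Sprung2012 Literature.NumberTheory.EllipticCurves.Rank1Residual
  Literature.NumberTheory.EllipticCurves.IwasawaAlgebra
  Summit.BirchSwinnertonDyer.BirchSwinnertonDyer.Theorems
  Summit.BirchSwinnertonDyer.Rank1Residual.Supersingular
  Summit.BirchSwinnertonDyer.Rank1Residual.X1.MuLambda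

namespace Summit.BirchSwinnertonDyer.BirchSwinnertonDyer.Theorems.ChromaticCommonZeros

/-! ### §1 Eisenstein rigidity in `Λ = ℤ_p⟦T⟧` -/

section Algebra

variable {p : ℕ} [hp : Fact p.Prime]

/-- `μ(F) = 0` for `F ≠ 0` means `F ≢ 0 (mod p)` (`F` is its own `p`-free part). [cite: Washington1997, §7.1] -/
theorem map_residue_ne_zero_of_mu_eq_zero {F : IwasawaAlgebra p} (hF : F ≠ 0) (hμ : mu F = 0) :
    F.map (IsLocalRing.residue ℤ_[p]) ≠ 0 := by
  have h := eq_C_pow_mu_mul_pfree F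
  rw [hμ, pow_zero, map_one, one_mul] at h
  have hred := red_pfree_ne_zero hF
  rw [← h] at hred
  exact hred

/-- The constant term of the Weierstrass polynomial has the same norm as `F(0)`: `F = P_F·U_F` with `U_F(0) ∈ ℤ_pˣ`.
[cite: Washington1997, §7.1 Thm. 7.3] -/
theorem norm_coeff_zero_weierstrassDistinguished {F : IwasawaAlgebra p} (hF' : F.map (IsLocalRing.residue ℤ_[p]) ≠ 0) :
    ‖(F.weierstrassDistinguished hF').coeff 0‖ = ‖PowerSeries.constantCoeff F‖ := by
  have hfac := F.eq_weierstrassDistinguished_mul_weierstrassUnit hF'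
  have hU := F.isUnit_weierstrassUnit hF'
  have hU0 : IsUnit (PowerSeries.constantCoeff (F.weierstrassUnit hF')) := PowerSeries.isUnit_constantCoeff _ hU
  have h0 : PowerSeries.constantCoeff F =
      (F.weierstrassDistinguished hF').coeff 0 * PowerSeries.constantCoeff (F.weierstrassUnit hF') := by
    conv_lhs => rw [hfac]
    rw [map_mul, ← PowerSeries.coeff_zero_eq_constantCoeff_apply (F.weierstrassDistinguished hF' : IwasawaAlgebra p),
      Polynomial.coeff_coe]
  rw [h0, norm_mul, PadicInt.isUnit_iff.mp hU0, mul_one]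

/-- **The Weierstrass polynomial of `F` is EISENSTEIN at `(p)` when `‖F(0)‖ = p⁻¹`** (and `F ≢ 0 mod p`): it is distinguished (monic, lower
coefficients in `(p)`) and its constant term has norm `p⁻¹`, so it is not in `(p²)`. [cite: Washington1997, §7.1 Thm. 7.3] [cite: Lang1990, Ch. 5 §2] -/
theorem isEisensteinAt_weierstrassDistinguished {F : IwasawaAlgebra p} (hF' : F.map (IsLocalRing.residue ℤ_[p]) ≠ 0)
    (h0 : ‖PowerSeries.constantCoeff F‖ = (p : ℝ)⁻¹) :
    (F.weierstrassDistinguished hF').IsEisensteinAt (IsLocalRing.maximalIdeal ℤ_[p]) := by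
  have hP : p.Prime := hp.out
  have hD := F.isDistinguishedAt_weierstrassDistinguished hF'
  refine ⟨?_, fun {k} hk ↦ hD.mem hk, ?_⟩
  · rw [hD.monic.leadingCoeff]
    exact (IsLocalRing.maximalIdeal.isMaximal ℤ_[p]).ne_top ∘ (Ideal.eq_top_of_isUnit_mem _ · isUnit_one)
  · rw [PadicInt.maximalIdeal_eq_span_p, Ideal.span_singleton_pow, Ideal.mem_span_singleton]
    rintro ⟨c, hc⟩
    have hnorm := norm_coeff_zero_weierstrassDistinguished hF'
    rw [h0, hc, norm_mul, norm_pow, PadicInt.norm_p] at hnorm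
    have hc1 : ‖c‖ ≤ 1 := PadicInt.norm_le_one c
    have hp1 : (1 : ℝ) < p := by exact_mod_cast hP.one_lt
    have hpos : (0 : ℝ) < (p : ℝ)⁻¹ := inv_pos.mpr (by linarith)
    -- `p⁻² · ‖c‖ ≤ p⁻² < p⁻¹`
    have hlt : (p : ℝ)⁻¹ ^ 2 * ‖c‖ < (p : ℝ)⁻¹ := by
      calc (p : ℝ)⁻¹ ^ 2 * ‖c‖ ≤ (p : ℝ)⁻¹ ^ 2 * 1 := by gcongr
        _ = (p : ℝ)⁻¹ * (p : ℝ)⁻¹ := by ring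
        _ < (p : ℝ)⁻¹ * 1 := by gcongr; exact inv_lt_one_of_one_lt₀ hp1
        _ = (p : ℝ)⁻¹ := mul_one _
    exact absurd hnorm (ne_of_lt hlt)

/-- The Weierstrass polynomial of such an `F` has positive degree (`λ(F) ≥ 1`): a distinguished polynomial of degree `0` is `1`, whose constant
term has norm `1 ≠ p⁻¹`. [cite: Washington1997, §7.1] -/
theorem natDegree_weierstrassDistinguished_pos {F : IwasawaAlgebra p} (hF' : F.map (IsLocalRing.residue ℤ_[p]) ≠ 0)
    (h0 : ‖PowerSeries.constantCoeff F‖ = (p : ℝ)⁻¹) : 0 < (F.weierstrassDistinguished hF').natDegree := by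
  have hP : p.Prime := hp.out
  by_contra hdeg
  have hdeg0 : (F.weierstrassDistinguished hF').natDegree = 0 := by omega
  have hmonic := (F.isDistinguishedAt_weierstrassDistinguished hF').monic
  have hone : F.weierstrassDistinguished hF' = 1 := by
    rw [Polynomial.eq_C_of_natDegree_eq_zero hdeg0] at hmonic ⊢
    rw [Polynomial.Monic, Polynomial.leadingCoeff_C] at hmonic
    rw [hmonic, map_one]
  have hnorm := norm_coeff_zero_weierstrassDistinguished hF'
  rw [h0, hone, Polynomial.coeff_one_zero, norm_one] at hnorm
  have hp1 : (1 : ℝ) < p := by exact_mod_cast hP.one_lt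
  exact absurd hnorm.symm (ne_of_lt (inv_lt_one_of_one_lt₀ hp1))

/-- **The Weierstrass polynomial of such an `F` is a PRIME element of `Λ`**: Eisenstein ⇒ irreducible in `ℤ_p[T]` (Gauss: monic hence primitive),
hence prime there (UFD); and `Λ/(P) ≅ ℤ_p[T]/(P)` by Weierstrass division for the distinguished `P` (`IsDistinguishedAt.algEquivQuotient`).
[cite: Washington1997, §7.1 Thm. 7.3] [cite: Lang1990, Ch. 5 §2] -/
theorem prime_coe_weierstrassDistinguished {F : IwasawaAlgebra p} (hF' : F.map (IsLocalRing.residue ℤ_[p]) ≠ 0)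
    (h0 : ‖PowerSeries.constantCoeff F‖ = (p : ℝ)⁻¹) :
    Prime ((F.weierstrassDistinguished hF' : ℤ_[p][X]) : IwasawaAlgebra p) := by
  set P := F.weierstrassDistinguished hF' with hPdef
  have hD : P.IsDistinguishedAt (IsLocalRing.maximalIdeal ℤ_[p]) := F.isDistinguishedAt_weierstrassDistinguished hF'
  have hirr : Irreducible P :=
    (isEisensteinAt_weierstrassDistinguished hF' h0).irreducible (IsLocalRing.maximalIdeal.isMaximal ℤ_[p]).isPrime
      hD.monic.isPrimitive (natDegree_weierstrassDistinguished_pos hF' h0)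
  have hne0 : P ≠ 0 := hD.monic.ne_zero
  have hne : ((P : ℤ_[p][X]) : IwasawaAlgebra p) ≠ 0 := by
    rw [Ne, Polynomial.coe_eq_zero_iff]
    exact hne0
  rw [← Ideal.span_singleton_prime hne, ← Ideal.Quotient.isDomain_iff_prime]
  have hdom : IsDomain (ℤ_[p][X] ⧸ Ideal.span {P}) := by
    rw [Ideal.Quotient.isDomain_iff_prime, Ideal.span_singleton_prime hne0]
    exact UniqueFactorizationMonoid.irreducible_iff_prime.mp hirr
  exact MulEquiv.isDomain (ℤ_[p][X] ⧸ Ideal.span {P}) hD.algEquivQuotient.symm.toMulEquiv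

/-- `(F) = (P_F)`: the Weierstrass unit does not change the ideal. [cite: Washington1997, §7.1 Thm. 7.3] -/
theorem span_eq_span_weierstrassDistinguished {F : IwasawaAlgebra p} (hF' : F.map (IsLocalRing.residue ℤ_[p]) ≠ 0) :
    Ideal.span {F} = Ideal.span {((F.weierstrassDistinguished hF' : ℤ_[p][X]) : IwasawaAlgebra p)} := by
  conv_lhs => rw [F.eq_weierstrassDistinguished_mul_weierstrassUnit hF']
  exact Ideal.span_singleton_mul_right_unit (F.isUnit_weierstrassUnit hF') _

/-- **Every height-one prime containing such an `F` is `(P_F)`.** `F = P_F·U_F ∈ 𝔭` with `U_F` a unit gives `P_F ∈ 𝔭`, and `P_F` is a prime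
element (`prime_coe_weierstrassDistinguished`), so `𝔭 = (P_F)` (Mathlib `Ideal.eq_span_singleton_of_height_eq_one`). Hence also `𝔭 = (F)`.
[cite: Washington1997, §7.1 Thm. 7.3 and §13.2] -/
theorem eq_span_of_mem_of_eisenstein {F : IwasawaAlgebra p} (hF : F ≠ 0) (hμ : mu F = 0)
    (h0 : ‖PowerSeries.constantCoeff F‖ = (p : ℝ)⁻¹) (𝔭 : PrimeSpectrum (IwasawaAlgebra p)) (h1 : 𝔭.asIdeal.height = 1)
    (hmem : F ∈ 𝔭.asIdeal) : 𝔭.asIdeal = Ideal.span {F} := by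
  have hF' := map_residue_ne_zero_of_mu_eq_zero hF hμ
  have hfac := F.eq_weierstrassDistinguished_mul_weierstrassUnit hF'
  have hU := F.isUnit_weierstrassUnit hF'
  -- `P_F ∈ 𝔭`
  have hPmem : ((F.weierstrassDistinguished hF' : ℤ_[p][X]) : IwasawaAlgebra p) ∈ 𝔭.asIdeal := by
    rw [hfac] at hmem
    rcases 𝔭.isPrime.mem_or_mem hmem with h | h
    · exact h
    · exact absurd (Ideal.eq_top_of_isUnit_mem _ h hU) 𝔭.isPrime.ne_top
  rw [span_eq_span_weierstrassDistinguished hF']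
  exact Ideal.eq_span_singleton_of_height_eq_one h1 hPmem (prime_coe_weierstrassDistinguished hF' h0)

/-- **EISENSTEIN RIGIDITY.** Two power series `F, G ∈ Λ ∖ 0` with `μ = 0` and constant terms of norm `p⁻¹` that lie in a COMMON height-one prime
generate the SAME ideal: `(F) = 𝔭 = (G)`. [cite: Washington1997, §7.1 Thm. 7.3 and §13.2] [cite: Lang1990, Ch. 5 §2] -/
theorem span_eq_span_of_mem_of_mem_of_eisenstein {F G : IwasawaAlgebra p} (hF : F ≠ 0) (hG : G ≠ 0)
    (hμF : mu F = 0) (hμG : mu G = 0)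
    (hF0 : ‖PowerSeries.constantCoeff F‖ = (p : ℝ)⁻¹) (hG0 : ‖PowerSeries.constantCoeff G‖ = (p : ℝ)⁻¹)
    (𝔭 : PrimeSpectrum (IwasawaAlgebra p)) (h1 : 𝔭.asIdeal.height = 1) (hFm : F ∈ 𝔭.asIdeal) (hGm : G ∈ 𝔭.asIdeal) :
    Ideal.span {F} = Ideal.span {G} := by
  rw [← eq_span_of_mem_of_eisenstein hF hμF hF0 𝔭 h1 hFm, ← eq_span_of_mem_of_eisenstein hG hμG hG0 𝔭 h1 hGm]

/-- Contrapositive: with the DATUM `(F) ≠ (G)`, no height-one prime of `Λ` contains both `F` and `G` — the equal-`λ` complement of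
`ChromaticSlopeSeparation.not_mem_and_mem_of_lam_ne` (w3 g3). [cite: Washington1997, §7.1 Thm. 7.3 and §13.2] -/
theorem not_mem_and_mem_of_span_ne {F G : IwasawaAlgebra p} (hF : F ≠ 0) (hG : G ≠ 0)
    (hμF : mu F = 0) (hμG : mu G = 0)
    (hF0 : ‖PowerSeries.constantCoeff F‖ = (p : ℝ)⁻¹) (hG0 : ‖PowerSeries.constantCoeff G‖ = (p : ℝ)⁻¹)
    (hne : Ideal.span {F} ≠ Ideal.span {G})
    (𝔭 : PrimeSpectrum (IwasawaAlgebra p)) (h1 : 𝔭.asIdeal.height = 1) : ¬ (F ∈ 𝔭.asIdeal ∧ G ∈ 𝔭.asIdeal) :=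
  fun h => hne (span_eq_span_of_mem_of_mem_of_eisenstein hF hG hμF hμG hF0 hG0 𝔭 h1 h.1 h.2)

end Algebra

/-! ### §2 (R9) X8: `v₃([0]⁺) = 1`, `μ♯ = μ♭ = 0`, `(L♯) ≠ (L♭)` ⟹ K1 for both colours -/

section R9

variable (W : WeierstrassCurve ℚ) [W.IsElliptic] [W.IsGloballyMinimal] (p : ℕ) [Fact p.Prime]

/-- **(R9) K1 for BOTH colours of an X8 pair from «`‖[0]⁺_f‖₃ = 1/3`, `μ♯ = μ♭ = 0`, `(L♯) ≠ (L♭)`»** — three per-pair data, the last one replacing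
the `λ♯ ≠ λ♭` of w3's (R4) (so the equal-`λ` cells are reached): `‖L♯(0)‖ = ‖L♭(0)‖ = 1/3` (`X8.norm_constantCoeff_chromaticL_eq`), Eisenstein
rigidity (§1) ⇒ no height-one prime contains both colours ⇒ at each such prime one colour's Néron-normalised function (`ϖ ∈ ℤ₃ˣ`) misses it ⇒
R0 `sprungSharpFlatLowerDivisibility_of_noCommonZero` (p609846). CONDITIONAL on `h714`, `h3`, `hJ` (displayed); PER PAIR; image-free; closes nothing.
[cite: Sprung2012, Prop. 6.14 (p. 1498), Thm. 7.14 (p. 1504), Prop. 7.19 and Main Conj. 7.21 (p. 1505)] [cite: Washington1997, §7.1 Thm. 7.3 and §13.2] -/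
theorem sprungSharpFlatLowerDivisibility_of_span_ne_of_norm_ratPlusSymbol
    (h714 : thm714_sharpFlatSelmerDual_finite_torsion) (h3 : realPeriodRat_eq_unit_mul_plusPeriod_three)
    (hJ : thm714seq_sharpFlatColemanKato_zetaJoint) (hX : ClassX8 W p)
    (hv : ∀ {N : ℕ} [NeZero N] (f : CuspForm (Gamma0 N) 2), IsNewformOf W f →
      ‖((ratPlusSymbol f 0 : ℚ) : ℚ_[p])‖ = (p : ℝ)⁻¹)
    (hdat : ∀ {N : ℕ} [NeZero N] (f : CuspForm (Gamma0 N) 2), IsNewformOf W f →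
      ∀ Lsharp Lflat : IwasawaAlgebra p, IsSprungPair f p (W.frobeniusTrace p) Lsharp Lflat →
        mu Lsharp = 0 ∧ mu Lflat = 0 ∧ Ideal.span {Lsharp} ≠ Ideal.span {Lflat})
    (col : Chroma) : SprungSharpFlatLowerDivisibility W p col := by
  refine sprungSharpFlatLowerDivisibility_of_noCommonZero W p h714 h3 hJ hX ?_ col
  intro N _ f ϖ Lsharp Lflat hf hϖ hSP 𝔭 h𝔭
  obtain ⟨hμs, hμf, hne⟩ := hdat f hf Lsharp Lflat hSP
  have hvf := hv f hf
  have hs0 : Lsharp ≠ 0 := X8.chromaticL_ne_zero_of_norm_ratPlusSymbol hX hf hSP hvf Chroma.sharp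
  have hf0 : Lflat ≠ 0 := X8.chromaticL_ne_zero_of_norm_ratPlusSymbol hX hf hSP hvf Chroma.flat
  have hcs : ‖PowerSeries.constantCoeff Lsharp‖ = (p : ℝ)⁻¹ := by
    rw [← chromaticL_sharp Lsharp Lflat, X8.norm_constantCoeff_chromaticL_eq hX hf hSP, hvf]
  have hcf : ‖PowerSeries.constantCoeff Lflat‖ = (p : ℝ)⁻¹ := by
    rw [← chromaticL_flat Lsharp Lflat, X8.norm_constantCoeff_chromaticL_eq hX hf hSP, hvf]
  -- one colour misses `𝔭` (Eisenstein rigidity)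
  have hmiss : ∃ col' : Chroma, chromaticL col' Lsharp Lflat ∉ 𝔭.asIdeal := by
    by_contra hall
    push Not at hall
    exact not_mem_and_mem_of_span_ne hs0 hf0 hμs hμf hcs hcf hne 𝔭 h𝔭
      ⟨by simpa using hall Chroma.sharp, by simpa using hall Chroma.flat⟩
  obtain ⟨col', hcol'⟩ := hmiss
  -- its Néron normalisation `C(u)·L^{col'}` misses `𝔭` as well
  have hϖ1 : ‖(ϖ : ℚ_[p])‖ = 1 := X8_norm_periodRatio_eq_one h3 W p hX hf hϖ
  set u : ℤ_[p]ˣ := PadicInt.mkUnits hϖ1 with hu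
  refine ⟨col', PowerSeries.C (u : ℤ_[p]) * chromaticL col' Lsharp Lflat, ?_, ?_⟩
  · rw [(span_C_units_mul_eq u (chromaticL col' Lsharp Lflat)).2, hu, PadicInt.mkUnits_eq]
  · exact fun hmem => hcol' ((Ideal.unit_mul_mem_iff_mem _ ((Units.isUnit u).map PowerSeries.C)).mp hmem)

end R9

/-! ### §3 (appended) A finite certificate for the datum `(F) ≠ (G)` -/

section Certificate

variable {p : ℕ} [Fact p.Prime]

/-- **Digit certificate for `(F) ≠ (G)`.** If the coefficients `G₀, …, G_m` are divisible by `p` (for the doors: `m + 1 ≤ λ(G)`, `μ(G) = 0`) and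
`p² ∤ F_{m+1}·G₀ − F₀·G_{m+1}`, then `(F) ≠ (G)`: were `F = G·u` with `u ∈ Λˣ`, then `F_{m+1} = G_{m+1}u₀ + Σ_{i ≤ m} G_i u_{m+1−i}` and
`F₀ = G₀u₀`, so `F_{m+1}G₀ − F₀G_{m+1} = G₀ · Σ_{i ≤ m} G_i u_{m+1−i} ∈ (p²)`. For the x8 census (R9 with `λ♯ = λ♭ = n`, `v₃(L^•(0)) = 1`): take
`m + 1 = n`; the test needs only `F_n, G_n mod 3` and the exact constant terms. [cite: Washington1997, §7.1] -/
theorem span_ne_of_cross_coeff_not_dvd {F G : IwasawaAlgebra p} (m : ℕ)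
    (hG : ∀ i ≤ m, (p : ℤ_[p]) ∣ PowerSeries.coeff i G)
    (hcert : ¬ (p : ℤ_[p]) ^ 2 ∣
      PowerSeries.coeff (m + 1) F * PowerSeries.constantCoeff G -
        PowerSeries.constantCoeff F * PowerSeries.coeff (m + 1) G) :
    Ideal.span {F} ≠ Ideal.span {G} := by
  intro heq
  obtain ⟨u, hu⟩ := (Ideal.span_singleton_eq_span_singleton.mp heq).symm
  apply hcert
  have hF : F = G * (u : IwasawaAlgebra p) := hu.symm
  set S : ℤ_[p] := ∑ q ∈ Finset.HasAntidiagonal.antidiagonal m,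
    PowerSeries.coeff q.1 G * PowerSeries.coeff (q.2 + 1) (u : IwasawaAlgebra p) with hS
  have hn : PowerSeries.coeff (m + 1) F =
      PowerSeries.coeff (m + 1) G * PowerSeries.constantCoeff (u : IwasawaAlgebra p) + S := by
    rw [hF, PowerSeries.coeff_mul, Finset.Nat.sum_antidiagonal_succ', PowerSeries.coeff_zero_eq_constantCoeff]
  have h0 : PowerSeries.constantCoeff F =
      PowerSeries.constantCoeff G * PowerSeries.constantCoeff (u : IwasawaAlgebra p) := by
    rw [hF, map_mul]
  have hring : PowerSeries.coeff (m + 1) F * PowerSeries.constantCoeff G -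
      PowerSeries.constantCoeff F * PowerSeries.coeff (m + 1) G = PowerSeries.constantCoeff G * S := by
    rw [hn, h0]; ring
  rw [hring, pow_two]
  refine mul_dvd_mul ?_ (Finset.dvd_sum fun q hq ↦ dvd_mul_of_dvd_left (hG q.1 ?_) _)
  · rw [← PowerSeries.coeff_zero_eq_constantCoeff_apply]
    exact hG 0 (Nat.zero_le m)
  · have := Finset.HasAntidiagonal.mem_antidiagonal.mp hq
    omega

end Certificate

end Summit.BirchSwinnertonDyer.BirchSwinnertonDyer.Theorems.ChromaticCommonZeros

end
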